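/-
Copyright (c) 2026. All rights reserved.
Released under Apache 2.0 license as described in the file LICENSE.
-/
import Summits.Langlands.Langlands.Theorems.SoloInformedRepairD2CrisTeichMinpoly
import HarnessLib

/-!
# `Ψ_a(M_a) = 0` on `D_cris(ρ_v)`: the `K₀`-eigenvalues form one Frobenius orbit of length `f`

Fourth input-free proof-side rung of the D2-cris repair (`SoloInformedRepairD2Cris.lean` §4,
`CrystallineCompatibleAt`: `charpoly (φ_D^{f}) = P^{f}` on `D_cris(ρ|Γ_{K_v})`, `q_v = p^f`); part two of the
Teichmüller-minimal-polynomial file (`…D2CrisTeichMinpoly`: `Ψ_a ∈ ℤ_p[X]` monic of degree `f`, `Ψ_a(u_a) = 0`,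
`Ψ_a ∣ Ψ_a(X^p)`).  Everything here is unconditional (no `θ`-surjectivity, no `B_max^{Γ_F} = F₀`, no
injectivity of `φ`).

* Abstract `D(ρ) = (E^m ⊗ B)^Γ`: `M` is `ℚ_p`-linear in the scalars (`mulD_algebraMap`), `M_b` is injective for
  `b ∈ B^Γ` a unit of `B` (`eq_zero_of_mulD_eq_zero_of_isUnit`), hence `M_{b₁} x = M_{b₂} x ⇒ x = 0` when
  `b₁ - b₂` is a unit (`eq_zero_of_mulD_eq_mulD`).
* On `D_cris(ρ_v)`, `q_F = p^f`, `a ∈ 𝒪_F`: **`Ψ_a(M_a) = 0`** (`eval₂_teichMinpoly_mulDcris`, coefficients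
  through `ℤ_p → ℚ_p → ℚ̄_p`); hence every eigenvalue `c` of `M_a` (`M_a x = c x`, `x ≠ 0`) is one of the `≤ f`
  roots of `Ψ_a` in `ℚ̄_p` (`eval₂_teichMinpoly_eq_zero_of_mulDcris_eq_smul`,
  `mem_roots_teichMinpoly_of_mulDcris_eq_smul`, `card_roots_teichMinpoly_le`); the root set is stable under
  `c ↦ c^p` (`eval₂_teichMinpoly_pow_eq_zero`); and **the Frobenius orbit of an eigenvalue has exact length**:
  `c^{p^i} ≠ c` whenever `ā^{p^i} ≠ ā` (`pow_ne_of_mulDcris_eq_smul`, from `M_a x = M_b x ⇒ x = 0` for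
  `ā ≠ b̄` — `u_a - u_b` is a unit of `B_max`, `isUnit_teichBmax_sub`); residues `ā` of exact degree `f`
  exist (`exists_resBar_pow_ne`, a lift of a generator of `k_F^×`).

Meaning for the clause: together with `φ_D M_a = M_a^p φ_D` (`…KzeroAction`), after base change to `ℚ̄_p` the
module `D_cris(ρ_v)` splits along the single Frobenius orbit `{c, c^p, …, c^{p^{f-1}}}` of `M_a`-eigenvalues
(`a` of degree `f`), `φ_D` carrying the `c^{p^{i}}`-eigenspace into the `c^{p^{i-1}}`-eigenspace; granted
injectivity of `φ` on `B_max(F)` (not in the tree) the `f` eigenspaces are isomorphic and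
`charpoly (φ_D^f) = charpoly (φ_D^f | D_c)^f`, i.e. the exponent `f` of `CrystallineCompatibleAt` is automatic.
That last step is NOT claimed here.

References: Fontaine, *Le corps des périodes p-adiques*, Astérisque 223 (1994), Exp. III §1.5, Exp. VIII
§2.3.7; Serre, *Local Fields*, Ch. I §1, Ch. II §4; Colmez, Ann. of Math. 148 (1998), §III.2.
-/

noncomputable section

open scoped MatrixGroups TensorProduct ValuativeRel Polynomial
open Field IsLocalRing ValuativeRel Polynomial
open Literature.NumberTheory.GaloisRepresentations Literature.NumberTheory.PAdicHodge
open Literature.NumberTheory.GaloisRepresentations.IsNonarchimedeanLocalField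

namespace Summit.Langlands.Langlands.Theorems

namespace D2Cris

open D2St

/-! ### §1 `M_{b₁} x = M_{b₂} x ⇒ x = 0` for `b₁ - b₂` a unit (abstract `D(ρ)`) -/

variable {F : Type} [Field F] [ValuativeRel F] [TopologicalSpace F] [IsNonarchimedeanLocalField F]
  [CharZero F] {p : ℕ} [Fact p.Prime] [Fact (¬ IsUnit (p : maxUnramifiedCompletion F))]
  [CharP (IsLocalRing.ResidueField (maxUnramifiedCompletion F)) p] [Fact (¬ IsUnit (p : integerC F))]
  [IsAdicComplete (Ideal.span {(p : integerC F)}) (integerC F)] {m : ℕ}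

section Abstract

variable {E : Type*} [Field E] [Algebra ℚ_[p] E] {Γ : Type*} {B : Type*} [CommRing B] [Algebra ℚ_[p] B]

/-- `1 ⊗ ((b₁ - b₂)·) = (1 ⊗ (b₁·)) - (1 ⊗ (b₂·))`. [folklore] -/
theorem endTensor_mulLeft_sub (b₁ b₂ : B) :
    endTensor (E := E) (m := m) (LinearMap.mulLeft ℚ_[p] (b₁ - b₂)) =
      endTensor (LinearMap.mulLeft ℚ_[p] b₁) - endTensor (LinearMap.mulLeft ℚ_[p] b₂) :=
  TensorProduct.AlgebraTensorModule.ext fun v y => by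
    rw [LinearMap.sub_apply, endTensor_mulLeft_tmul, endTensor_mulLeft_tmul, endTensor_mulLeft_tmul,
      sub_mul, TensorProduct.tmul_sub]

/-- `1 ⊗ (c·) = c • id` for a scalar `c ∈ ℚ_p` (the tensor is over `ℚ_p`). [folklore] -/
theorem endTensor_mulLeft_algebraMap (c : ℚ_[p]) :
    endTensor (E := E) (m := m) (LinearMap.mulLeft ℚ_[p] (algebraMap ℚ_[p] B c)) =
      algebraMap ℚ_[p] E c • LinearMap.id :=
  TensorProduct.AlgebraTensorModule.ext fun v y => by
    rw [endTensor_mulLeft_tmul, LinearMap.smul_apply, LinearMap.id_apply, ← Algebra.smul_def,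
      ← TensorProduct.smul_tmul, TensorProduct.smul_tmul', algebraMap_smul]

/-- **`M` is `ℚ_p`-linear in the period: `M_c = c · id` for `c ∈ ℚ_p ⊆ B^Γ`.** [folklore] -/
theorem mulD_algebraMap (ρ : Γ → GL (Fin m) E) (gal : Γ → (B →ₐ[ℚ_[p]] B)) (c : ℚ_[p]) :
    mulD ρ gal (algebraMap ℚ_[p] (fixedSubalgebra gal) c) =
      algebraMap E (Module.End E (invariants ρ gal)) (algebraMap ℚ_[p] E c) :=
  LinearMap.ext fun x => Subtype.ext <| by
    rw [coe_mulD, Subalgebra.coe_algebraMap, endTensor_mulLeft_algebraMap, Module.algebraMap_end_apply,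
      LinearMap.smul_apply, LinearMap.id_apply, Submodule.coe_smul]

/-- **`M_b` is injective for `b ∈ B^Γ` a unit of `B`**: `M_b x = 0 ⇒ x = 0`. [folklore] -/
theorem eq_zero_of_mulD_eq_zero_of_isUnit (ρ : Γ → GL (Fin m) E) (gal : Γ → (B →ₐ[ℚ_[p]] B))
    {b : fixedSubalgebra gal} (hb : IsUnit (b : B)) {x : invariants ρ gal} (hx : mulD ρ gal b x = 0) :
    x = 0 := by
  obtain ⟨u, hu⟩ := hb
  have h1 : endTensor (E := E) (m := m) (LinearMap.mulLeft ℚ_[p] (↑u⁻¹ : B)) ∘ₗ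
      endTensor (LinearMap.mulLeft ℚ_[p] (b : B)) = LinearMap.id := by
    rw [← endTensor_mulLeft_mul, ← hu, Units.inv_mul, endTensor_mulLeft_one]
  have h2 := LinearMap.congr_fun h1 (x : (Fin m → E) ⊗[ℚ_[p]] B)
  rw [LinearMap.comp_apply, ← coe_mulD, hx, ZeroMemClass.coe_zero, map_zero, LinearMap.id_apply] at h2
  exact Subtype.ext h2.symm

/-- `M_{b₁} x = M_{b₂} x ⇒ x = 0` when `b₁ - b₂` is a unit of `B`. [folklore] -/
theorem eq_zero_of_mulD_eq_mulD (ρ : Γ → GL (Fin m) E) (gal : Γ → (B →ₐ[ℚ_[p]] B))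
    {b₁ b₂ : fixedSubalgebra gal} (hb : IsUnit ((b₁ : B) - b₂)) {x : invariants ρ gal}
    (hx : mulD ρ gal b₁ x = mulD ρ gal b₂ x) : x = 0 :=
  eq_zero_of_mulD_eq_zero_of_isUnit ρ gal (b := b₁ - b₂) (by rwa [AddSubgroupClass.coe_sub]) <|
    Subtype.ext <| by
      rw [coe_mulD, AddSubgroupClass.coe_sub, endTensor_mulLeft_sub, LinearMap.sub_apply, ← coe_mulD,
        ← coe_mulD, hx, sub_self, Submodule.coe_zero]

end Abstract

/-! ### §2 `Ψ_a(M_a) = 0` on `D_cris(ρ_v)` and the Frobenius orbit of the eigenvalues -/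

variable (p) in
/-- The coefficient map `ℤ_p → ℚ_p → ℚ̄_p`. [folklore] -/
def zpToAlgCl : ℤ_[p] →+* PadicAlgCl p := (algebraMap ℚ_[p] (PadicAlgCl p)).comp PadicInt.Coe.ringHom

section Dcris

variable {f : ℕ} (hq : residueFieldCard F = p ^ f)

/-- **`Ψ_a(M_a) = 0` on `D_cris(ρ_v)`**: the `K₀`-generator `M_a` of `End D_cris(ρ_v)` is annihilated by the
degree-`f` polynomial `Ψ_a ∈ ℤ_p[X]` (coefficients acting through `ℤ_p ⊆ ℚ_p ⊆ ℚ̄_p`), because `M` is a ring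
homomorphism on `B_max^{Γ_F} ∋ u_a` and `Ψ_a(u_a) = 0`. [cite: FontaineAsterisque223III, Exp. III §1.5] -/
theorem eval₂_teichMinpoly_mulDcris (ρv : FramedRep (absoluteGaloisGroup F) (PadicAlgCl p) m) (a : 𝒪[F]) :
    (teichMinpoly hq a).eval₂
      ((algebraMap (PadicAlgCl p) (Module.End (PadicAlgCl p) (Dcris (F := F) (p := p) ρv))).comp (zpToAlgCl p))
      (mulDcris ρv a) = 0 := by
  set S := fixedSubalgebra (galBmaxAlgHom (F := F) (p := p)) with hS
  set iS : ℤ_[p] →+* S := (algebraMap ℚ_[p] S).comp PadicInt.Coe.ringHom with hiS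
  have h1 : (S.val : S →+* Bmax F p).comp iS = zpToBmax F p := RingHom.ext fun c => by
    rw [RingHom.comp_apply, hiS, RingHom.comp_apply, zpToBmax_eq_algebraMap]
    rfl
  have h2 : (teichMinpoly hq a).eval₂ iS (teichPeriod F p a) = 0 := by
    apply Subtype.ext
    change (S.val : S →+* Bmax F p) ((teichMinpoly hq a).eval₂ iS (teichPeriod F p a)) = ((0 : S) : Bmax F p)
    rw [Polynomial.hom_eval₂, h1, ZeroMemClass.coe_zero]
    exact eval₂_teichMinpoly_teichBmax hq a
  have h3 : (mulD ρv (galBmaxAlgHom (F := F) (p := p))).comp iS =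
      (algebraMap (PadicAlgCl p) (Module.End (PadicAlgCl p) (Dcris (F := F) (p := p) ρv))).comp
        (zpToAlgCl p) := RingHom.ext fun c => by
    rw [RingHom.comp_apply, hiS, RingHom.comp_apply, mulD_algebraMap]
    rfl
  have h4 := Polynomial.hom_eval₂ (teichMinpoly hq a) iS (mulD ρv (galBmaxAlgHom (F := F) (p := p)))
    (teichPeriod F p a)
  rw [h2, map_zero, h3] at h4
  exact h4.symm

/-- On a `c`-eigenvector of `M_a`, `P(M_a)` acts by `P(c)` (`P ∈ ℤ_p[X]`). [folklore] -/
theorem eval₂_apply_of_mulDcris_eq_smul (ρv : FramedRep (absoluteGaloisGroup F) (PadicAlgCl p) m) (a : 𝒪[F])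
    {x : Dcris (F := F) (p := p) ρv} {c : PadicAlgCl p} (hx : mulDcris ρv a x = c • x) (P : ℤ_[p][X]) :
    (P.eval₂ ((algebraMap (PadicAlgCl p) (Module.End (PadicAlgCl p) (Dcris (F := F) (p := p) ρv))).comp
      (zpToAlgCl p)) (mulDcris ρv a)) x = P.eval₂ (zpToAlgCl p) c • x := by
  induction P using Polynomial.induction_on' with
  | add P Q hP hQ =>
    rw [Polynomial.eval₂_add, Polynomial.eval₂_add, LinearMap.add_apply, hP, hQ, add_smul]
  | monomial n r =>
    rw [Polynomial.eval₂_monomial, Polynomial.eval₂_monomial, Module.End.mul_apply,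
      mulDcris_pow_apply_of_eq_smul ρv a hx, RingHom.comp_apply, Module.algebraMap_end_apply, smul_smul]

/-- **Eigenvalues of `M_a` are roots of `Ψ_a`**: if `M_a x = c x` with `x ≠ 0` then `Ψ_a(c) = 0` in `ℚ̄_p`.
[cite: FontaineAsterisque223VIII, §2.3.7] -/
theorem eval₂_teichMinpoly_eq_zero_of_mulDcris_eq_smul (ρv : FramedRep (absoluteGaloisGroup F) (PadicAlgCl p) m)
    (a : 𝒪[F]) {x : Dcris (F := F) (p := p) ρv} {c : PadicAlgCl p} (hx : mulDcris ρv a x = c • x)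
    (hx0 : x ≠ 0) : (teichMinpoly hq a).eval₂ (zpToAlgCl p) c = 0 := by
  have h := eval₂_apply_of_mulDcris_eq_smul ρv a hx (teichMinpoly hq a)
  rw [eval₂_teichMinpoly_mulDcris hq ρv a, LinearMap.zero_apply] at h
  exact (smul_eq_zero.mp h.symm).resolve_right hx0

/-- … equivalently `c ∈ roots (Ψ_a)` in `ℚ̄_p`. [folklore] -/
theorem mem_roots_teichMinpoly_of_mulDcris_eq_smul (ρv : FramedRep (absoluteGaloisGroup F) (PadicAlgCl p) m)
    (a : 𝒪[F]) {x : Dcris (F := F) (p := p) ρv} {c : PadicAlgCl p} (hx : mulDcris ρv a x = c • x)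
    (hx0 : x ≠ 0) : c ∈ ((teichMinpoly hq a).map (zpToAlgCl p)).roots := by
  rw [Polynomial.mem_roots ((teichMinpoly_monic hq a).map _).ne_zero, Polynomial.IsRoot, Polynomial.eval_map]
  exact eval₂_teichMinpoly_eq_zero_of_mulDcris_eq_smul hq ρv a hx hx0

omit [CharZero F] [IsAdicComplete (Ideal.span {(p : integerC F)}) (integerC F)]
  [Fact (¬ IsUnit (p : integerC F))] [Fact (¬ IsUnit (p : maxUnramifiedCompletion F))] in
/-- **At most `f` eigenvalues**: `Ψ_a` has at most `f` roots in `ℚ̄_p`. [folklore] -/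
theorem card_roots_teichMinpoly_le (a : 𝒪[F]) :
    Multiset.card ((teichMinpoly hq a).map (zpToAlgCl p)).roots ≤ f :=
  (Polynomial.card_roots' _).trans
    (by rw [(teichMinpoly_monic hq a).natDegree_map, natDegree_teichMinpoly])

omit [CharZero F] [IsAdicComplete (Ideal.span {(p : integerC F)}) (integerC F)]
  [Fact (¬ IsUnit (p : integerC F))] [Fact (¬ IsUnit (p : maxUnramifiedCompletion F))] in
/-- **Frobenius stability of the roots**: `Ψ_a(c) = 0 ⇒ Ψ_a(c^p) = 0` in `ℚ̄_p`. [folklore] -/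
theorem eval₂_teichMinpoly_pow_eq_zero (a : 𝒪[F]) {c : PadicAlgCl p}
    (hc : (teichMinpoly hq a).eval₂ (zpToAlgCl p) c = 0) :
    (teichMinpoly hq a).eval₂ (zpToAlgCl p) (c ^ p) = 0 := by
  have hd := Polynomial.map_dvd (zpToAlgCl p) (teichMinpoly_dvd_expand hq a)
  rw [Polynomial.map_expand] at hd
  have h := Polynomial.eval_eq_zero_of_dvd_of_eval_eq_zero hd (by rwa [Polynomial.eval_map])
  rwa [Polynomial.expand_eval, Polynomial.eval_map] at h

/-- `u_a - u_b` is a unit of `B_max(F)` for `ā ≠ b̄`. [cite: FontaineAsterisque223III, Exp. II §2.3] -/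
theorem isUnit_teichBmax_sub {a b : 𝒪[F]} (h : resBar F a ≠ resBar F b) :
    IsUnit (teichBmax (p := p) a - teichBmax b) := by
  have hu := (isUnit_teichmuller_sub (p := p) h).map ((ainfToBmax F p).comp (wittToAinf F p))
  rw [map_sub] at hu
  exact hu

/-- **`M_a x = M_b x ⇒ x = 0` for `ā ≠ b̄`** (`M_a - M_b = M_{u_a - u_b}`, a unit acting). [folklore] -/
theorem eq_zero_of_mulDcris_eq_mulDcris (ρv : FramedRep (absoluteGaloisGroup F) (PadicAlgCl p) m) {a b : 𝒪[F]}
    (h : resBar F a ≠ resBar F b) {x : Dcris (F := F) (p := p) ρv} (hx : mulDcris ρv a x = mulDcris ρv b x) :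
    x = 0 :=
  eq_zero_of_mulD_eq_mulD ρv (galBmaxAlgHom (F := F) (p := p)) (b₁ := teichPeriod F p a)
    (b₂ := teichPeriod F p b) (by rw [coe_teichPeriod, coe_teichPeriod]; exact isUnit_teichBmax_sub h) hx

/-- **The Frobenius orbit of an eigenvalue has exact length**: if `M_a x = c x`, `x ≠ 0`, and `ā^{p^i} ≠ ā`,
then `c^{p^i} ≠ c`.  For `ā` of degree `f` over `𝔽_p` the `f` conjugates `c, c^p, …, c^{p^{f-1}}` are therefore
distinct: they exhaust the roots of `Ψ_a`. [cite: FontaineAsterisque223VIII, §2.3.7] -/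
theorem pow_ne_of_mulDcris_eq_smul (ρv : FramedRep (absoluteGaloisGroup F) (PadicAlgCl p) m) {a : 𝒪[F]}
    {x : Dcris (F := F) (p := p) ρv} {c : PadicAlgCl p} (hx : mulDcris ρv a x = c • x) (hx0 : x ≠ 0) {i : ℕ}
    (hi : resBar F a ^ p ^ i ≠ resBar F a) : c ^ p ^ i ≠ c := fun hc => hx0 <| by
  refine eq_zero_of_mulDcris_eq_mulDcris ρv (a := a ^ p ^ i) (b := a) (by rwa [map_pow]) ?_
  rw [map_pow, mulDcris_pow_apply_of_eq_smul ρv a hx, hc, hx]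

omit [CharZero F] [IsAdicComplete (Ideal.span {(p : integerC F)}) (integerC F)]
  [Fact (¬ IsUnit (p : integerC F))] [CharP (IsLocalRing.ResidueField (maxUnramifiedCompletion F)) p]
  [Fact (¬ IsUnit (p : maxUnramifiedCompletion F))] in
include hq in
/-- **Residues of degree `f` exist**: for `q_F = p^f` some unit `a ∈ 𝒪_F` has `ā^{p^i} ≠ ā` for all
`0 < i < f` (lift a generator of the cyclic group `k_F^×`). [cite: SerreLocalFields1979, Ch. I §1] -/
theorem exists_resBar_pow_ne :
    ∃ a : 𝒪[F], a ∉ 𝓂[F] ∧ ∀ i, 0 < i → i < f → resBar F a ^ p ^ i ≠ resBar F a := by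
  have hp : p.Prime := Fact.out
  obtain ⟨g, hg⟩ := IsCyclic.exists_generator (α := (𝓀[F])ˣ)
  have hord : orderOf g = p ^ f - 1 := by
    rw [orderOf_eq_card_of_forall_mem_zpowers hg, Nat.card_units, ← hq]
    rfl
  obtain ⟨a, ha⟩ := IsLocalRing.residue_surjective (R := 𝒪[F]) (g : 𝓀[F])
  refine ⟨a, fun hm => g.ne_zero (by rw [← ha]; exact (IsLocalRing.residue_eq_zero_iff _).2 hm),
    fun i hi hif h => ?_⟩
  have h1 : a ^ p ^ i - a ∈ 𝓂[F] := (resBar_eq_zero_iff _).1 (by rw [map_sub, map_pow, h, sub_self])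
  have h2 : (g : 𝓀[F]) ^ p ^ i = g := by
    rw [← ha, ← map_pow, ← sub_eq_zero, ← map_sub]
    exact (IsLocalRing.residue_eq_zero_iff _).2 h1
  have h3 : g ^ p ^ i = g := Units.ext (by rw [Units.val_pow_eq_pow_val]; exact h2)
  have hpi : p ^ i ≠ 0 := (pow_pos hp.pos i).ne'
  have h4 : g ^ (p ^ i - 1) = 1 :=
    mul_right_cancel (b := g) (by rw [pow_sub_one_mul hpi, h3, one_mul])
  have h5 : p ^ f - 1 ∣ p ^ i - 1 := hord ▸ orderOf_dvd_of_pow_eq_one h4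
  have h6 : p ^ i < p ^ f := Nat.pow_lt_pow_right hp.one_lt hif
  have h7 : 0 < p ^ i - 1 := Nat.sub_pos_of_lt (Nat.one_lt_pow hi.ne' hp.one_lt)
  have h8 := Nat.le_of_dvd h7 h5
  omega

end Dcris

end D2Cris

end Summit.Langlands.Langlands.Theorems
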